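import Literature.NumberTheory.Sieve.BombieriFriedlanderIwaniecDispersion
import HarnessLib

/-!
# Fouvry–Radziwiłł, *Level of distribution of unbalanced convolutions*, §1 (statements)

Topic `NumberTheory/Sieve` (level of distribution; next to the Bombieri–Friedlander–Iwaniec
dispersion files whose dyadic-range vocabulary `BFI.dyadic` — "`n ∼ N` means `N < n ≤ 2N`" — is
exactly the convention of this source, §1.1: "we will abbreviate this in subscripts as `n ∼ N`").
É. Fouvry, M. Radziwiłł, *Level of distribution of unbalanced convolutions*, Ann. Sci. Éc. Norm.
Supér. (4) 55 (2022), arXiv:1811.08672 [FouvryRadziwill2022].  Read on the held arXiv text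
[corpus:paper:arxiv-1811.08672, chunks p0003 (§1: Definition 1, Corollary 1.1), p0004–p0005
(Corollaries 1.2–1.6), p0006 (§1.1: (1.3)–(1.6), Theorems 1.1, 1.2)].  STATEMENTS ONLY (D-0014 /
D-0064: one file for the source's §1): the objects of §1.1 are definitions with bodies, the four
results are named facts `def … : Prop` with the printed hypotheses, constants and ranges verbatim;
nothing is proved here and nothing is weakened.

What is typed (all for COMPLEX sequences, as in Theorems 1.1/1.2):

* `FouvryRadziwill2022.IsSiegelWalfiszWith k C β` / `IsSiegelWalfisz β` — **Definition 1** (the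
  Siegel–Walfisz condition: for every `A > 0`, uniformly in `x ≥ 2`, `q > |a| ≥ 1`, `r ≥ 1`,
  `(a,q) = 1`: `∑_{x<n≤2x, n≡a (q), (n,r)=1} β_n = φ(q)⁻¹ ∑_{x<n≤2x, (n,qr)=1} β_n + O_A(τ_k(r) x (log x)^{−A})`),
  with the data `k` and the constants `C A` made explicit so that implied constants may depend on
  them.
* `IsDivisorBounded k α` — the standing size hypothesis "`|α_m| ≤ τ_k(m)` for all `m ≥ 1`", where
  `τ_k = ζ^{*k}` is the `k`-fold divisor function, spelled `(ArithmeticFunction.zeta ^ k) n` (the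
  same term as `Literature.NumberTheory.LFunctions.Zhang2022.Section3.tauK`, not imported here to
  keep this Sieve-level module light).
* `l2Norm N β = ‖β‖_{2,N}`; `discE` = `E(β,N,q,a)` (1.3); `discEstar` = `E⋆(β,N,q,a;r)` (1.4);
  `bilinE` = `E(α,β,M,N,q,a)`; `Delta` = `Δ(α,β,M,N,Q,a)` (1.5); `calEstar` = `𝓔⋆(β,N,Q)` (1.6);
  `bilinEWindow` = the bracket of Corollary 1.1 (the same as `bilinE` with the extra
  multiplicative constraint `x < mn ≤ 2x`, "essentially a technicality", p0006).
* `FouvryRadziwill2022.theorem11` — **Theorem 1.1** (the dispersion estimate).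
* `FouvryRadziwill2022.theorem12` — **Theorem 1.2** (prime moduli, NO Siegel–Walfisz hypothesis).
* `FouvryRadziwill2022.corollary11` — **Corollary 1.1** (level of distribution `x^{1/2+1/66−ε}`
  for unbalanced convolutions, conditions (i)/(ii)/(iii)).
* `FouvryRadziwill2022.corollary15` — **Corollary 1.5** (sieve weights `∑_{d∣n, d≤z} λ_d` of level
  up to `x^{53/105−ε}` / `x^{1/2+δ−ε}` to moduli as large as `x^{1−ε}`).

INDEX ONLY (printed in §1, not typed here; type on request): Corollary 1.2 (`τ_k` to moduli
`x^{17/33−ε}`, saving `(log x)^{1−ε}`), Corollary 1.3 (multiplicative `g`, `|g| ≤ τ_k`, `1_p·g`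
Siegel–Walfisz, level `17/33`), Corollary 1.4 (`Ω(n) = k`, `k ≥ 2`), Corollary 1.6
(Brun–Titchmarsh for almost all `q ∈ [x^θ, 2x^θ]` with constant `4 − 2/53`, resp. `66/(17−36η)`).

Rendering decisions (faithfulness notes).

1. *Ranges.* `n ∼ N` is `BFI.dyadic N` (`N < n ≤ 2N`, p0006 §1.1 verbatim). In Corollary 1.1
   the moduli run over "`Q ≤ q ≤ 2Q`" (closed at `Q`, as printed in (1.2)); we sum over
   `1 ≤ q ≤ ⌊2Q⌋` with the filter `Q ≤ q` (moduli are positive integers).  In Corollary 1.5 and in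
   `Delta` the moduli run over `q ∼ Q` as printed.
2. *Residues.* `a : ℤ`; "`n ≡ a (mod q)`" is `(n : ZMod q) = (a : ZMod q)`, "`(q,a) = 1`" is
   `IsCoprime (q : ℤ) a`; in Definition 1 "`q > |a| ≥ 1`" is `1 ≤ a.natAbs < q`.
3. *Implicit positivity.* Theorem 1.1 is stated for "`M, N, Q` and `D` such that
   `M > Q(MN)^ε`, `M > N > D^{10}`"; we add the implicit `0 < Q` and `1 ≤ D` (a modulus scale and a
   cut parameter; `D` enters only through `N > D^{10}`, `D^{−1/2}`, `D^{C}`) — without them the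
   real powers `Q^{33/20}`, `D^{−1/2}` are not the printed quantities.  No other hypothesis is added.
4. *Constants.* "`≪_{k,ε}` … for some constants `κ = κ(k)` and `C = C(k,ε)`" is rendered
   `∀ k ε, ∃ κ C K, …`; in Corollary 1.1 "`≪_A`" may depend on `k, ε, A` AND on the Siegel–Walfisz
   data `(k_sw, C_sw)` of `β` (standard reading of "Suppose that β is Siegel–Walfisz"); the
   sequences of Corollary 1.1 are supported on the dyadic ranges as printed
   ("`α = (α_m)_{M<m≤2M}`, `β = (β_n)_{N<n≤2N}`"), which matters because the Siegel–Walfisz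
   hypothesis sees the whole sequence `β`.
5. `X = MN` in Theorems 1.1/1.2; `log`, `exp`, real powers are `Real.log`, `Real.exp`, `Real.rpow`.

Bearing (cell landau-siegel §B-ell, ELL-CENSUS v1.0 §0/§5 — tag E*-ℓ, live form "(14.8)
D-uniform via bilinear Kloosterman fractions"): the engine behind Theorem 1.1 is the trilinear
Kloosterman-fraction sum `Σ(U,V,W) = U⁻¹ ∑_{u∼U} ∑_{v∼V} ∑_{w∼W} x_u y_v z_w e(u v̄/w)` with
`Q^{1−o(1)} ≤ V, W ≤ Q^{1+o(1)}`, `U ≤ Q^{2+o(1)}/M` (p0006–p0007), bounded by Duke–Friedlander–Iwaniec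
(tree: `Literature.NumberTheory.LFunctions.DukeFriedlanderIwaniec1997_bilinearKloostermanFractions`,
proved) and Bettin–Chandee (tree: `…BettinChandee2018_trilinearKloostermanFractions`).  What it
would need to bite on Zhang's (14.8): a modulus `Dk` with a FIXED factor `D` of size comparable to
the variables and a numerator variable longer than the modulus — neither is a range printed here
(the 2026 sequel "Trilinear Kloosterman fractions I: partially fixed moduli", arXiv:2604.25177,
Theorem 2.1, treats the fixed factor; typed separately by the cell).

## References

* É. Fouvry, M. Radziwiłł, *Level of distribution of unbalanced convolutions*, Ann. Sci. Éc.
  Norm. Supér. (4) 55 (2022), doi:10.24033/asens.2501, arXiv:1811.08672: §1 Definition 1,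
  Corollaries 1.1–1.6; §1.1 (1.3)–(1.6), Theorems 1.1, 1.2. [FouvryRadziwill2022]
* E. Bombieri, J. B. Friedlander, H. Iwaniec, *Primes in arithmetic progressions to large moduli*,
  Acta Math. 156 (1986), 203–251 (the dyadic convention `n ∼ N`). [BombieriFriedlanderIwaniecActa1986]

«The programme SEARCHES and TYPES; no claim about Landau–Siegel zeros, Theorems 1–2 of
arXiv:2211.02515 or a repaired Margin232 until a kernel theorem says so.»
-/

noncomputable section

open Finset Real

namespace Literature.NumberTheory.Sieve

namespace FouvryRadziwill2022

/-! ### §1.1 objects -/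

/-- `‖β‖_{2,N} = (∑_{N<n≤2N} |β_n|²)^{1/2}`, the `ℓ₂` norm over the dyadic range (§1.1, p0006).
[cite: FouvryRadziwill2022, §1.1] -/
def l2Norm (N : ℝ) (β : ℕ → ℂ) : ℝ :=
  Real.sqrt (∑ n ∈ BFI.dyadic N, ‖β n‖ ^ 2)

/-- The standing size hypothesis of §1: "`|α_m| ≤ τ_k(m)` for all `m ≥ 1`", with `τ_k(n) =
∑_{n₁⋯n_k = n} 1` the `k`-fold divisor function (Definition 1, p0003), i.e. the `k`-th Dirichlet
power of the constant function `1`: `τ_k = (ArithmeticFunction.zeta)^k`.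
[cite: FouvryRadziwill2022, §1 Definition 1 and Corollary 1.1] -/
def IsDivisorBounded (k : ℕ) (α : ℕ → ℂ) : Prop :=
  ∀ n : ℕ, 1 ≤ n → ‖α n‖ ≤ (((ArithmeticFunction.zeta ^ k : ArithmeticFunction ℕ) n : ℕ) : ℝ)

/-- **Definition 1 (Siegel–Walfisz condition), with explicit data** (p0003): the complex sequence
`β` satisfies, with the divisor exponent `k > 0` and constants `C A`, for every `A > 0`,
uniformly in `x ≥ 2`, `q > |a| ≥ 1`, `r ≥ 1` and `(a,q) = 1`:
`|∑_{x<n≤2x, n≡a (q), (n,r)=1} β_n − φ(q)⁻¹ ∑_{x<n≤2x, (n,qr)=1} β_n| ≤ C(A) τ_k(r) x (log x)^{−A}`.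
[cite: FouvryRadziwill2022, §1 Definition 1] -/
def IsSiegelWalfiszWith (k : ℕ) (C : ℝ → ℝ) (β : ℕ → ℂ) : Prop :=
  0 < k ∧ ∀ A : ℝ, 0 < A → ∀ x : ℝ, 2 ≤ x → ∀ (q r : ℕ) (a : ℤ),
    1 ≤ a.natAbs → a.natAbs < q → 1 ≤ r → IsCoprime (q : ℤ) a →
      ‖(∑ n ∈ BFI.dyadic x, if (n : ZMod q) = (a : ZMod q) ∧ n.Coprime r then β n else 0) -
          (∑ n ∈ BFI.dyadic x, if n.Coprime (q * r) then β n else 0) / ((Nat.totient q : ℕ) : ℂ)‖ ≤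
        C A * (((ArithmeticFunction.zeta ^ k : ArithmeticFunction ℕ) r : ℕ) : ℝ) * x / Real.log x ^ A

/-- **Definition 1 (Siegel–Walfisz condition)** as printed: "there exists an integer `k > 0` such
that for any fixed `A > 0`, uniformly in `x ≥ 2`, `q > |a| ≥ 1`, `r ≥ 1` and `(a,q) = 1`" the
estimate of `IsSiegelWalfiszWith` holds with SOME constants `O_A`.
[cite: FouvryRadziwill2022, §1 Definition 1] -/
def IsSiegelWalfisz (β : ℕ → ℂ) : Prop :=
  ∃ (k : ℕ) (C : ℝ → ℝ), IsSiegelWalfiszWith k C β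

/-- `E(β, N, q, a) := ∑_{n∼N, n≡a (q)} β_n − φ(q)⁻¹ ∑_{n∼N, (n,q)=1} β_n` — the discrepancy (1.3).
[cite: FouvryRadziwill2022, (1.3)] -/
def discE (β : ℕ → ℂ) (N : ℝ) (q : ℕ) (a : ℤ) : ℂ :=
  (∑ n ∈ BFI.dyadic N, if (n : ZMod q) = (a : ZMod q) then β n else 0) -
    (∑ n ∈ BFI.dyadic N, if n.Coprime q then β n else 0) / ((Nat.totient q : ℕ) : ℂ)

/-- `E⋆(β, N, q, a; r) := ∑_{n∼N, n≡a (q), (n,r)=1} β_n − φ(q)⁻¹ ∑_{n∼N, (n,qr)=1} β_n` — the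
variant (1.4), "defined for all `r ≥ 1`". [cite: FouvryRadziwill2022, (1.4)] -/
def discEstar (β : ℕ → ℂ) (N : ℝ) (q : ℕ) (a : ℤ) (r : ℕ) : ℂ :=
  (∑ n ∈ BFI.dyadic N, if (n : ZMod q) = (a : ZMod q) ∧ n.Coprime r then β n else 0) -
    (∑ n ∈ BFI.dyadic N, if n.Coprime (q * r) then β n else 0) / ((Nat.totient q : ℕ) : ℂ)

/-- `E(α, β, M, N, q, a) := ∑∑_{m∼M, n∼N, mn≡a (q)} α_m β_n − φ(q)⁻¹ ∑∑_{m∼M, n∼N, (mn,q)=1} α_m β_n`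
(§1.1, p0006; the complex-coefficient analogue of `BFI.bilinDisc`).
[cite: FouvryRadziwill2022, §1.1] -/
def bilinE (α β : ℕ → ℂ) (M N : ℝ) (q : ℕ) (a : ℤ) : ℂ :=
  (∑ m ∈ BFI.dyadic M, ∑ n ∈ BFI.dyadic N,
      if ((m * n : ℕ) : ZMod q) = (a : ZMod q) then α m * β n else 0) -
    (∑ m ∈ BFI.dyadic M, ∑ n ∈ BFI.dyadic N,
      if (m * n).Coprime q then α m * β n else 0) / ((Nat.totient q : ℕ) : ℂ)

/-- `Δ(α, β, M, N, Q, a) := ∑_{q∼Q, (q,a)=1} |E(α, β, M, N, q, a)|` (1.5).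
[cite: FouvryRadziwill2022, (1.5)] -/
def Delta (α β : ℕ → ℂ) (M N Q : ℝ) (a : ℤ) : ℝ :=
  ∑ q ∈ BFI.dyadic Q, if IsCoprime (q : ℤ) a then ‖bilinE α β M N q a‖ else 0

/-- `𝓔⋆(β, N, Q) := ∑_δ ∑_{v∼Q/δ} ∑_{(δ',δ)=1} |E⋆(β, N, δ, δ'; v)|²` (1.6), "the contribution of
the small moduli": `δ ≥ 1` (only `δ ≤ 2Q` contribute, the range `v ∼ Q/δ` being empty beyond),
`δ'` over the residues modulo `δ` coprime to `δ`. [cite: FouvryRadziwill2022, (1.6)] -/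
def calEstar (β : ℕ → ℂ) (N Q : ℝ) : ℝ :=
  ∑ δ ∈ Icc 1 ⌊2 * Q⌋₊, ∑ v ∈ BFI.dyadic (Q / δ),
    ∑ δ' ∈ (range δ).filter (fun d => d.Coprime δ), ‖discEstar β N δ (δ' : ℤ) v‖ ^ 2

/-- The bracket of Corollary 1.1 / (1.2): `E(α,β,M,N,q,a)` with the additional multiplicative
constraint `x < mn ≤ 2x` (p0006: "Corollary 1.1 also differs from Theorem 1.1 by the addition of
the multiplicative constraint `x < mn ≤ 2x`. This is essentially a technicality.").
[cite: FouvryRadziwill2022, (1.2) and §1.1] -/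
def bilinEWindow (α β : ℕ → ℂ) (M N x : ℝ) (q : ℕ) (a : ℤ) : ℂ :=
  (∑ m ∈ BFI.dyadic M, ∑ n ∈ BFI.dyadic N,
      if x < (m * n : ℕ) ∧ ((m * n : ℕ) : ℝ) ≤ 2 * x ∧ ((m * n : ℕ) : ZMod q) = (a : ZMod q)
      then α m * β n else 0) -
    (∑ m ∈ BFI.dyadic M, ∑ n ∈ BFI.dyadic N,
      if x < (m * n : ℕ) ∧ ((m * n : ℕ) : ℝ) ≤ 2 * x ∧ (m * n).Coprime q
      then α m * β n else 0) / ((Nat.totient q : ℕ) : ℂ)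

/-! ### §1.1 Theorem 1.1 — the dispersion estimate -/

/-- **Fouvry–Radziwiłł 2022, Theorem 1.1** (p0006), as printed: "Let `k ≥ 1` be an integer and let
`ε > 0` be given. Suppose that `M, N, Q` and `D` are such that `M > Q (MN)^ε`, `M > N > D^{10}`.
Let `X = MN`. Let `α = (α_m)_{m∼M}` and `β = (β_n)_{n∼N}` be two sequences of complex numbers such
that `|α_m| ≤ τ_k(m)` and `|β_n| ≤ τ_k(n)` for all `m, n ≥ 1`. Then, for all integers
`1 ≤ |a| ≤ X/3` we have
`Δ(α,β,M,N,Q,a) ≪_{k,ε} ‖α‖_{2,M} · ( M Q⁻¹ 𝓔⋆(β,N,Q) + (log X)^κ N² Q + (log X)^κ D^{−1/2} M N²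
  + D^{C} X^{ε} ( M^{3/20} N^{59/20} Q^{33/20} + N^{23/8} Q^{15/8} ) )^{1/2}`
for some constants `κ = κ(k)` and `C = C(k, ε)`, depending only on `k` and `k, ε` respectively."
Implicit positivity `0 < Q`, `1 ≤ D` added (module docstring, item 3).  Named fact, not proved
here. [cite: FouvryRadziwill2022, Theorem 1.1] -/
def theorem11 : Prop :=
  ∀ k : ℕ, 1 ≤ k → ∀ ε : ℝ, 0 < ε → ∃ κ C K : ℝ, 0 < K ∧
    ∀ M N Q D : ℝ, 0 < Q → 1 ≤ D →
      Q * (M * N) ^ ε < M → N < M → D ^ (10 : ℕ) < N →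
    ∀ α β : ℕ → ℂ, IsDivisorBounded k α → IsDivisorBounded k β →
    ∀ a : ℤ, 1 ≤ a.natAbs → (a.natAbs : ℝ) ≤ M * N / 3 →
      Delta α β M N Q a ≤
        K * l2Norm M α *
          Real.sqrt (M / Q * calEstar β N Q
            + Real.log (M * N) ^ κ * N ^ 2 * Q
            + Real.log (M * N) ^ κ * D ^ (-(1 / 2 : ℝ)) * M * N ^ 2
            + D ^ C * (M * N) ^ ε *
                (M ^ (3 / 20 : ℝ) * N ^ (59 / 20 : ℝ) * Q ^ (33 / 20 : ℝ)
                  + N ^ (23 / 8 : ℝ) * Q ^ (15 / 8 : ℝ)))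

/-! ### §1.1 Theorem 1.2 — prime moduli, no Siegel–Walfisz hypothesis -/

/-- **Fouvry–Radziwiłł 2022, Theorem 1.2** (p0006), as printed: "Let `k ≥ 1` be an integer and let
`ε > 0` be given. Let `α = (α_m)_{m∼M}` and `β = (β_n)_{n∼N}` be two sequences of complex numbers
such that `|α_m| ≤ τ_k(m)` and `|β_n| ≤ τ_k(n)` for all `m,n ≥ 1`. Let `X = MN`. Then, uniformly in
`M, N ≥ 1`, and `1 ≤ |a| ≤ X/3`,
`∑_{q∼Q, q prime, (q,a)=1} |E(α,β,M,N,q,a)| = O_{ε,k}( MN exp(−(√(log N))/2) )`,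
provided that `exp((log X)^ε) ≤ N ≤ Q^{−11/12} X^{17/36−ε}` and `Q ≥ exp(√(log N))`."
(In particular, ibid.: true for `Q = X^{1/2}` and `exp((log X)^ε) ≤ N ≤ X^{1/72−ε}`.)  No
Siegel–Walfisz hypothesis.  Named fact, not proved here. [cite: FouvryRadziwill2022, Theorem 1.2] -/
def theorem12 : Prop :=
  ∀ k : ℕ, 1 ≤ k → ∀ ε : ℝ, 0 < ε → ∃ K : ℝ, 0 < K ∧
    ∀ M N Q : ℝ, 1 ≤ M → 1 ≤ N →
      Real.exp (Real.log (M * N) ^ ε) ≤ N →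
      N ≤ Q ^ (-(11 / 12 : ℝ)) * (M * N) ^ (17 / 36 - ε) →
      Real.exp (Real.sqrt (Real.log N)) ≤ Q →
    ∀ α β : ℕ → ℂ, IsDivisorBounded k α → IsDivisorBounded k β →
    ∀ a : ℤ, 1 ≤ a.natAbs → (a.natAbs : ℝ) ≤ M * N / 3 →
      (∑ q ∈ BFI.dyadic Q, if q.Prime ∧ IsCoprime (q : ℤ) a then ‖bilinE α β M N q a‖ else 0) ≤
        K * (M * N) * Real.exp (-(Real.sqrt (Real.log N)) / 2)

/-! ### §1 Corollary 1.1 — level of distribution of unbalanced convolutions -/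

/-- **Fouvry–Radziwiłł 2022, Corollary 1.1** (p0003), as printed: "Let `k > 0` and `ε > 0` be given.
Let `α = (α_m)_{M<m≤2M}` and `β = (β_n)_{N<n≤2N}` be two sequences of complex numbers such that
`|α_m| ≤ τ_k(m)` and `|β_n| ≤ τ_k(n)` for all `m,n ≥ 1`. Suppose that `β` is Siegel–Walfisz. Then
for every `A > 0`, uniformly in `M, N ≥ 2` with `MN/2 ≤ x ≤ 4MN` we have
`∑_{Q≤q≤2Q, (q,a)=1} | ∑_{x<mn≤2x, mn≡a (q)} α_m β_n − φ(q)⁻¹ ∑_{x<mn≤2x, (mn,q)=1} α_m β_n | ≪_A x (log x)^{−A}`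
provided that either of the following three conditions holds:
(i) `exp((log x)^ε) ≤ N ≤ Q^{−11/12} x^{17/36−ε}` and `1 ≤ |a| ≤ x/12`;
(ii) `exp((log x)^ε) ≤ N ≤ x^{7/90−ε}`, `Q ≤ x^{53/105−ε}` and `1 ≤ |a| ≤ x/12`;
(iii) `exp((log x)^ε) ≤ N ≤ x^{101/630−ε}`, `Q ≤ x^{53/105−ε}` and `1 ≤ |a| ≤ (x/4)^{ε/1000}`."
(p0004: "(i) gives the strongest estimate in the `Q`-aspect for very small `N`, allowing for `Q`
to go up to `x^{1/2+1/66−3ε}` provided that `N ≤ x^ε`".)  The implied constant may depend on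
`k, ε, A` and on the Siegel–Walfisz data of `β` (module docstring, item 4); `α, β` are supported on
their dyadic ranges as printed.  Named fact, not proved here.
[cite: FouvryRadziwill2022, Corollary 1.1] -/
def corollary11 : Prop :=
  ∀ k : ℕ, 0 < k → ∀ ε : ℝ, 0 < ε → ∀ (ksw : ℕ) (Csw : ℝ → ℝ), ∀ A : ℝ, 0 < A → ∃ K : ℝ,
    ∀ M N x Q : ℝ, 2 ≤ M → 2 ≤ N → M * N / 2 ≤ x → x ≤ 4 * M * N →
    ∀ α β : ℕ → ℂ, IsDivisorBounded k α → IsDivisorBounded k β →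
      (∀ m : ℕ, α m ≠ 0 → M < m ∧ (m : ℝ) ≤ 2 * M) →
      (∀ n : ℕ, β n ≠ 0 → N < n ∧ (n : ℝ) ≤ 2 * N) →
      IsSiegelWalfiszWith ksw Csw β →
    ∀ a : ℤ,
      ((Real.exp (Real.log x ^ ε) ≤ N ∧ N ≤ Q ^ (-(11 / 12 : ℝ)) * x ^ (17 / 36 - ε) ∧
          1 ≤ a.natAbs ∧ (a.natAbs : ℝ) ≤ x / 12) ∨
        (Real.exp (Real.log x ^ ε) ≤ N ∧ N ≤ x ^ (7 / 90 - ε) ∧ Q ≤ x ^ (53 / 105 - ε) ∧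
          1 ≤ a.natAbs ∧ (a.natAbs : ℝ) ≤ x / 12) ∨
        (Real.exp (Real.log x ^ ε) ≤ N ∧ N ≤ x ^ (101 / 630 - ε) ∧ Q ≤ x ^ (53 / 105 - ε) ∧
          1 ≤ a.natAbs ∧ (a.natAbs : ℝ) ≤ (x / 4) ^ (ε / 1000))) →
      (∑ q ∈ Icc 1 ⌊2 * Q⌋₊,
          if Q ≤ q ∧ IsCoprime (q : ℤ) a then ‖bilinEWindow α β M N x q a‖ else 0) ≤
        K * x / Real.log x ^ A

/-! ### §1 Corollary 1.5 — sieve weights to moduli near `x` -/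

/-- **Fouvry–Radziwiłł 2022, Corollary 1.5** (p0005), as printed: "Let `ε > 0` and `k > 0` be given.
Let `λ = (λ_d)_{1≤d≤z}` be a sequence of complex numbers with `|λ_d| ≤ τ_k(d)`. Then, we have
`∑_{q∼Q, (q,a)=1} | ∑_{x<n≤2x, n≡a (q)} (∑_{d∣n, d≤z} λ_d) − φ(q)⁻¹ ∑_{x<n≤2x, (n,q)=1} (∑_{d∣n, d≤z} λ_d) | ≪_A x (log x)^{−A}`,
provided that either of the following three conditions holds:
(i) `x ≥ 12`, `z ≤ x^{53/105−ε}`, `x^{1−ε} > Q > x^{529/630+ε}` and `1 ≤ |a| ≤ x^{ε/10000}`;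
(ii) `x ≥ 12`, `z ≤ x^{53/105−ε}`, `x^{1−ε} > Q > x^{83/90+ε}` and `1 ≤ |a| ≤ x^{1−3ε}`;
(iii) `x ≥ 12`, `z ≤ x^{1/2+δ−ε}`, `x^{1−ε} > Q > x^{(71+66δ)/72+ε}`, and `1 ≤ |a| ≤ x^{1−3ε}`
for any fixed `0 < δ < 1/66`. In this case the implicit constant in `≪_A` depends additionally on
`δ`."  (`529/630 = 0.83962…`, `83/90 = 0.92222…`, `71/72 = 0.98611…`.)  Rendered with the weight
`w(n) = ∑_{d ∣ n, d ≤ z} λ_d` over `Nat.divisors n`; the constant `K` may depend on `ε, k, δ, A`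
(for (i)/(ii) any admissible `δ` will do).  Named fact, not proved here.
[cite: FouvryRadziwill2022, Corollary 1.5] -/
def corollary15 : Prop :=
  ∀ ε : ℝ, 0 < ε → ∀ k : ℕ, 0 < k → ∀ δ : ℝ, 0 < δ → δ < 1 / 66 → ∀ A : ℝ, 0 < A → ∃ K : ℝ,
    ∀ x z Q : ℝ, ∀ lam : ℕ → ℂ, IsDivisorBounded k lam → ∀ a : ℤ, 12 ≤ x →
      ((z ≤ x ^ (53 / 105 - ε) ∧ x ^ (529 / 630 + ε) < Q ∧ Q < x ^ (1 - ε) ∧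
          1 ≤ a.natAbs ∧ (a.natAbs : ℝ) ≤ x ^ (ε / 10000)) ∨
        (z ≤ x ^ (53 / 105 - ε) ∧ x ^ (83 / 90 + ε) < Q ∧ Q < x ^ (1 - ε) ∧
          1 ≤ a.natAbs ∧ (a.natAbs : ℝ) ≤ x ^ (1 - 3 * ε)) ∨
        (z ≤ x ^ (1 / 2 + δ - ε) ∧ x ^ ((71 + 66 * δ) / 72 + ε) < Q ∧ Q < x ^ (1 - ε) ∧
          1 ≤ a.natAbs ∧ (a.natAbs : ℝ) ≤ x ^ (1 - 3 * ε))) →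
      (∑ q ∈ BFI.dyadic Q,
          if IsCoprime (q : ℤ) a then
            ‖(∑ n ∈ BFI.dyadic x,
                if (n : ZMod q) = (a : ZMod q) then
                  ∑ d ∈ (Nat.divisors n).filter (fun d : ℕ => (d : ℝ) ≤ z), lam d else 0) -
              (∑ n ∈ BFI.dyadic x,
                if n.Coprime q then
                  ∑ d ∈ (Nat.divisors n).filter (fun d : ℕ => (d : ℝ) ≤ z), lam d else 0) /
                ((Nat.totient q : ℕ) : ℂ)‖
          else 0) ≤
        K * x / Real.log x ^ A

/-! ### Small proved API (unfolding / sanity) -/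

/-- `Δ ≥ 0` (a sum of norms; unfolding of (1.5)). [cite: FouvryRadziwill2022, (1.5)] -/
theorem Delta_nonneg (α β : ℕ → ℂ) (M N Q : ℝ) (a : ℤ) : 0 ≤ Delta α β M N Q a := by
  unfold Delta
  refine Finset.sum_nonneg fun q _ => ?_
  split_ifs
  · exact norm_nonneg _
  · exact le_rfl

/-- `𝓔⋆ ≥ 0` (a sum of squares; unfolding of (1.6)). [cite: FouvryRadziwill2022, (1.6)] -/
theorem calEstar_nonneg (β : ℕ → ℂ) (N Q : ℝ) : 0 ≤ calEstar β N Q := by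
  unfold calEstar
  exact Finset.sum_nonneg fun _ _ => Finset.sum_nonneg fun _ _ =>
    Finset.sum_nonneg fun _ _ => sq_nonneg _

/-- `E⋆(β, N, q, a; 1) = E(β, N, q, a)`: the variant (1.4) at `r = 1` is (1.3).
[cite: FouvryRadziwill2022, (1.3)–(1.4)] -/
theorem discEstar_one (β : ℕ → ℂ) (N : ℝ) (q : ℕ) (a : ℤ) :
    discEstar β N q a 1 = discE β N q a := by
  unfold discEstar discE
  simp [Nat.coprime_one_right_eq_true]

/-- A Siegel–Walfisz sequence with explicit data is Siegel–Walfisz (Definition 1, unfolding).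
[cite: FouvryRadziwill2022, §1 Definition 1] -/
theorem IsSiegelWalfiszWith.isSiegelWalfisz {k : ℕ} {C : ℝ → ℝ} {β : ℕ → ℂ}
    (h : IsSiegelWalfiszWith k C β) : IsSiegelWalfisz β :=
  ⟨k, C, h⟩

end FouvryRadziwill2022

end Literature.NumberTheory.Sieve

end
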